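import Summits.BirchSwinnertonDyer.BirchSwinnertonDyer.Theorems.ClassRecordThreeEulerHalvesAtThreeKolyvaginRedefinition
import Summits.BirchSwinnertonDyer.Rank1Residual.X11b.BDPRouteOnTreeStepL
import Summits.BirchSwinnertonDyer.Rank1Residual.X11b.KolyvaginBottomPoint
import Literature.NumberTheory.EllipticCurves.HeegnerPointsOfConductorOneData
import HarnessLib

/-!
# `stub_jetchevMaxHLAtThree` (item 19109 `EulerHalvesAtThree`, skeleton v4) VERBATIM from FIVE named
# print facts + the per-level inequality: the `y_K`-non-torsion input `hy` of
# `jetchevMaxHLAtThree_of_prop52_of_perLevel` (p489581) DISCHARGED by name from Darmon 2004 Thm. 3.6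
# (datum supply), Shimura reciprocity at conductor 1, Gross–Zagier and modularity (cell `bsd-stepL`,
# seat `bsd-stepL-tam3-p1`, helper toward item 19109)

HONEST FRAMING. CONDITIONAL on five named, unproved Literature facts (`def … : Prop`, used as
hypotheses BY NAME): McCallum 1991 Prop. 5.2 (`McCallum1991.prop52_exists_conductor_kolyvaginClass_order_eq`),
Darmon 2004 Thm. 3.6 (`phi_heegnerTau_mem_singularModuliField`), Shimura reciprocity at conductor 1
(`heegnerPointOfConductor_one_galoisConj`) — the last two are conjuncts of skeleton v4's
`stub_kolyFactsAtThree` —, Gross–Zagier (`gross_zagier`) and modularity (`hasEntireLFunction_rat`) —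
conjuncts 1 and 7 of item 19112 `PublishedInputsThree`; plus the per-level inequality `hlev`, which
is the conclusion of `JET.Section6.tamagawaExponent_le_m_of_selmerFamilies` (p484791) once its
level-`3^k` Selmer families are INSTANTIATED at the frame's admissible conductors (the instantiation
layer S1∕S2∕S3∕S4∕S5∕S7∕S10 of the `bsd-jet` sheet `PV2-J6-KERNEL.md` — NOT in the tree). Nothing
is discharged unconditionally; the stub stays OPEN; no item closes; 0 classes move (T7);
`--supports stmt-BirchSwinnertonDyer-19109` (helper).
WHAT IS PROVED: `exists_kolyvaginHeegnerData_one_not_isOfFinAddOrder` — at a frame of the stub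
(`ord_{s=1}L(E,s) = 1`, `K` imaginary quadratic Heegner, `L(E^{d_K},1) ≠ 0`, orientation `β`), a
conductor-1 Kolyvagin–Heegner datum `d₁` exists (`exists_kolyvaginHeegnerData_one`, granted Darmon
Thm. 3.6) and its derived point `P_1` is of infinite order: it is the image of a Heegner point
`P₀ ∈ E(K)` (`heegnerSystem_exists_isHeegnerPoint_map_eq_derivedPoint_one`, granted Shimura
reciprocity), `P₀` is non-torsion by Gross–Zagier + modularity
(`X11b.not_isOfFinAddOrder_of_heegner_of_analyticRank_eq_one`: `L′(E/K,1) = L′(E,1)·L(E^{d_K},1) ≠ 0`)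
and `E(K) → E(K[1])` is injective. `jetchevMaxHLAtThree_of_facts_of_perLevel` = the composition with
p489581. So the reading-grade stub reads, IN THE TREE: {5 print facts} + {instantiation of the
kernel §6}. References (locators only; the facts are imported, not declared): [cite: Jetchev2008,
Thm. 1.4 (p. 812), Proof of Thm. 1.4 (p. 825)] [cite: McCallumLMS1991, §5 Prop. 5.2 (p. 304)]
[cite: GrossLMS1991, §4 (4.1)] [cite: GrossZagier1986, Thm. I.(6.3)] [cite: Darmon2004, Thm. 3.6].
Design: theorems only. Axioms: `propext`, `Classical.choice`, `Quot.sound`.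
-/

set_option autoImplicit false

noncomputable section

open scoped Classical NumberField

namespace Summit.BirchSwinnertonDyer.Rank1Residual.X11b.Three.Koly

open WeierstrassCurve Literature.NumberTheory.EllipticCurves
  Literature.NumberTheory.EllipticCurves.ModularForms
  Literature.NumberTheory.EllipticCurves.Rank1Residual
  Summit.BirchSwinnertonDyer.Rank1Residual Summit.BirchSwinnertonDyer.Rank1Residual.X11b
  IsDedekindDomain

/-- **A conductor-1 Kolyvagin–Heegner datum with `P_1 = y_K` of infinite order, at a frame of the
stub, from four named facts.** The datum exists by `exists_kolyvaginHeegnerData_one` (granted Darmon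
2004 Thm. 3.6 as `phi_heegnerTau_mem_singularModuliField`); its derived point is the image of a Heegner
point `P₀ ∈ E(K)` (`heegnerSystem_exists_isHeegnerPoint_map_eq_derivedPoint_one`, granted Shimura
reciprocity at conductor 1 as `heegnerPointOfConductor_one_galoisConj`); `P₀` is non-torsion by
Gross–Zagier and modularity on the frame `ord_{s=1} L(E,s) = 1`, `L(E^{d_K},1) ≠ 0`
(`X11b.not_isOfFinAddOrder_of_heegner_of_analyticRank_eq_one`); `E(K) → E(K[1])` is injective.
CONDITIONAL on the four facts. [cite: GrossLMS1991, §4 (4.1)] [cite: GrossZagier1986, Thm. I.(6.3)]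
[cite: Darmon2004, Thm. 3.6] -/
theorem exists_kolyvaginHeegnerData_one_not_isOfFinAddOrder
    (W : WeierstrassCurve ℚ) [W.IsElliptic] [W.IsGloballyMinimal] [NeZero (W.conductorNorm ℤ)]
    (K : Type) [Field K] [NumberField K]
    (hD36 : phi_heegnerTau_mem_singularModuliField (W.conductorNorm ℤ) W K)
    (hrec : heegnerPointOfConductor_one_galoisConj (W.conductorNorm ℤ) W K)
    (hGZ : gross_zagier (W.conductorNorm ℤ) W K) (hmod : hasEntireLFunction_rat)
    (Dt : ModularParametrizationData W (W.conductorNorm ℤ)) (β : ℤ) (ι : K →+* ℂ)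
    (hr : W.analyticRank = 1) (hK : IsImaginaryQuadratic K)
    (hHN : SatisfiesHeegnerHypothesis (W.conductorNorm ℤ) K)
    (hLt : (W.quadraticTwist (NumberField.discr K : ℚ)).entireLFunction 1 ≠ 0)
    (hβ : (4 * (W.conductorNorm ℤ : ℤ)) ∣ β ^ 2 - NumberField.discr K) :
    ∃ d₁ : KolyvaginHeegnerData Dt β ι 1, ¬ IsOfFinAddOrder d₁.derivedPoint := by
  obtain ⟨d₁⟩ := exists_kolyvaginHeegnerData_one hD36 hK Dt β ι hβ
  obtain ⟨P₀, ⟨Dt', H', ι', hP'⟩, hmap⟩ :=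
    heegnerSystem_exists_isHeegnerPoint_map_eq_derivedPoint_one hrec hK hHN d₁
  have hnt : ¬ IsOfFinAddOrder P₀ :=
    X11b.not_isOfFinAddOrder_of_heegner_of_analyticRank_eq_one W (W.conductorNorm ℤ) K Dt' H' ι' P₀
      hGZ hmod hr hK hHN hLt hP'
  refine ⟨d₁, fun h => hnt ?_⟩
  rw [← hmap] at h
  exact ((WeierstrassCurve.Affine.Point.map_injective (W' := W)
    (f := (algebraMap K (ringClassField K ι 1)).toRatAlgHom)).isOfFinAddOrder_iff).mp h

/-- **`stub_jetchevMaxHLAtThree` VERBATIM from five named print facts and the per-level inequality.**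
Facts (all `def … : Prop` in `Literature`, used BY NAME as hypotheses — the theorem is CONDITIONAL on
them): McCallum 1991 Prop. 5.2 (`h52`, typed by `bsd-jet-lit-ty`), Darmon 2004 Thm. 3.6 (`hD36`),
Shimura reciprocity at conductor 1 (`hrec`) — the last two are conjuncts of skeleton v4's
`stub_kolyFactsAtThree` —, Gross–Zagier (`hGZ`) and modularity (`hmod`) — conjuncts 1 and 7 of item
19112 `PublishedInputsThree`. The sixth hypothesis `hlev` is the per-level inequality
`ord₃ c_v ≤ m(n)` (`m(n) < k`, `ord₃ c_v ≤ k`, `k + m(n) ≤ M(n)`) = the conclusion of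
`JET.Section6.tamagawaExponent_le_m_of_selmerFamilies` (p484791) once its level-`3^k` Selmer families
are INSTANTIATED on `H¹(K, E[3^k])` at the admissible conductors of the frame — NOT in the tree. So
the tree now shows: `stub_jetchevMaxHLAtThree ⟸ {5 print facts} + {instantiation of the kernel §6}`;
Jetchev 2008 §§5–6 contribute no further input. Nothing is discharged unconditionally; the stub
stays open; no item closes; 0 classes move (T7). [cite: Jetchev2008, Thm. 1.4 (p. 812), Proof of
Thm. 1.4 (p. 825)] [cite: McCallumLMS1991, §5 Prop. 5.2 (p. 304)] [cite: Darmon2004, Thm. 3.6]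
[cite: GrossZagier1986, Thm. I.(6.3)] -/
theorem jetchevMaxHLAtThree_of_facts_of_perLevel
    (h52 : McCallum1991.prop52_exists_conductor_kolyvaginClass_order_eq)
    (hD36 : ∀ (N : ℕ) [NeZero N] (W : WeierstrassCurve ℚ) (K : Type) [Field K] [NumberField K],
      phi_heegnerTau_mem_singularModuliField N W K)
    (hrec : ∀ (N : ℕ) [NeZero N] (W : WeierstrassCurve ℚ) (K : Type) [Field K] [NumberField K],
      heegnerPointOfConductor_one_galoisConj N W K)
    (hGZ : ∀ (N : ℕ) [NeZero N] (W : WeierstrassCurve ℚ) (K : Type) [Field K] [NumberField K],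
      gross_zagier N W K)
    (hmod : hasEntireLFunction_rat)
    (hlev : ∀ (W : WeierstrassCurve ℚ) [W.IsElliptic] [W.IsGloballyMinimal] [NeZero (W.conductorNorm ℤ)]
      (K : Type) [Field K] [NumberField K]
      (Dt : ModularParametrizationData W (W.conductorNorm ℤ)) (β : ℤ) (ι : K →+* ℂ),
      W.analyticRank = 1 → W.HasMultiplicativeReductionAtPrime 3 → Surj W 3 →
      IsImaginaryQuadratic K → SatisfiesHeegnerHypothesis (W.conductorNorm ℤ) K →
      Odd (NumberField.discr K) → (W.quadraticTwist (NumberField.discr K : ℚ)).entireLFunction 1 ≠ 0 →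
      (4 * (W.conductorNorm ℤ : ℤ)) ∣ β ^ 2 - NumberField.discr K → ¬ (3 : ℤ) ∣ Dt.c →
      ∀ (v : HeightOneSpectrum (𝓞 ℚ)) (k n : ℕ) (d : KolyvaginHeegnerData Dt β ι n), Squarefree n →
        (∀ ℓ ∈ n.primeFactors, Zhang2014.IsKolyvaginPrime (W.conductorNorm ℤ) W K 3 ℓ) →
        (if divOrd d 3 < Zhang2014.levelIndex W 3 n then divOrd d 3 else (⊤ : ℕ∞)) < (k : ℕ∞) →
        padicValNat 3 (W.tamagawaNumberAt v) ≤ k →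
        (k : ℕ∞) + (if divOrd d 3 < Zhang2014.levelIndex W 3 n then divOrd d 3 else ⊤) ≤
          Zhang2014.levelIndex W 3 n →
        (padicValNat 3 (W.tamagawaNumberAt v) : ℕ∞) ≤
          (if divOrd d 3 < Zhang2014.levelIndex W 3 n then divOrd d 3 else ⊤)) :
    ∀ (W : WeierstrassCurve ℚ) [W.IsElliptic] [W.IsGloballyMinimal] [NeZero (W.conductorNorm ℤ)]
      (K : Type) [Field K] [NumberField K]
      (Dt : ModularParametrizationData W (W.conductorNorm ℤ)) (β : ℤ) (ι : K →+* ℂ),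
      W.analyticRank = 1 → W.HasMultiplicativeReductionAtPrime 3 → Surj W 3 →
      IsImaginaryQuadratic K → SatisfiesHeegnerHypothesis (W.conductorNorm ℤ) K →
      Odd (NumberField.discr K) → (W.quadraticTwist (NumberField.discr K : ℚ)).entireLFunction 1 ≠ 0 →
      (4 * (W.conductorNorm ℤ : ℤ)) ∣ β ^ 2 - NumberField.discr K → ¬ (3 : ℤ) ∣ Dt.c →
      ∀ (v : HeightOneSpectrum (𝓞 ℚ)) (s : ℕ), s ≤ padicValNat 3 (W.tamagawaNumberAt v) →
        ∀ (n : ℕ) (d : KolyvaginHeegnerData Dt β ι n), Squarefree n →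
          (∀ ℓ ∈ n.primeFactors, Zhang2014.IsKolyvaginPrime (W.conductorNorm ℤ) W K 3 ℓ ∧
            s ≤ Zhang2014.kolyvaginIndex W 3 ℓ) → PDiv d 3 s :=
  jetchevMaxHLAtThree_of_prop52_of_perLevel h52
    (fun W _ _ _ K _ _ Dt β ι hr _ _ hK hHN _ hLt hβ _ =>
      exists_kolyvaginHeegnerData_one_not_isOfFinAddOrder W K (hD36 _ W K) (hrec _ W K) (hGZ _ W K)
        hmod Dt β ι hr hK hHN hLt hβ)
    hlev

end Summit.BirchSwinnertonDyer.Rank1Residual.X11b.Three.Koly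

end
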